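import Mathlib
import HarnessLib
import Summits.ResolutionOfSingularities.ResolutionOfSingularities.Theorems.WildQuotientsWildQuotientResolutionEigenlineChartOrigin

/-!
# Fractions `a/s` (`a ∈ 𝔫`, `s ∉ 𝔫`) in the local ring `S[𝔪/t]_𝔫 ⊆ K` of a point blow-up, and `W/x_i ⊆ 𝔫`
# (crux `WildQuotients.WildQuotientResolution`, stub `stub_phaseZeroHighDim`; Kollár–Szabó going down, step (K2))

Crux stmt-ResolutionOfSingularities-15640 (`WildQuotientResolution`), registered stub `stub_phaseZeroHighDim`.
Companion of ✓`EigenlineChartOrigin` (p827786: the chart origin `𝔫 ∋ x_i, x_j/x_i` of `S[𝔪/x_i]`, `S ⊆ K` regular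
local) and input of `EigenlineQuadraticTransform` (the EQUIVARIANT quadratic transform): elementary bookkeeping of
the maximal ideal of the local subring `S[𝔪/t]_𝔫 = LocalSubring.ofPrime (blowupRing S t) 𝔫 ⊆ K` read in `K` as the
set of fractions `b/s` with `b ∈ 𝔫`, `s ∉ 𝔫` — closed under sums, negatives, products with elements of
`S[𝔪/t]_𝔫`; such fractions are NON-UNITS of `S[𝔪/t]_𝔫` (`eq_zero_or_inv_not_mem_of_frac`) and a unit plus such a
fraction is a unit (`inv_add_mem_ofPrime`) — and the inclusion `W/x_i ⊆ 𝔫` for every ideal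
`W ≤ (x_j : j ≠ i) + 𝔪²` (`div_mem_chartOrigin_of_mem`: the tangent hyperplane `[W]` IS the chart origin).

[OURS · crux stmt-ResolutionOfSingularities-15640 · helper toward `stub_phaseZeroHighDim` (step (K2) of the
Kollár–Szabó going-down tower instance; NOT a proof of the stub); folklore local algebra, counted 0; AI-level work,
weaker than expert review.] [folklore]
-/

-- single-problem summit: the doubled namespace component `ResolutionOfSingularities` is forced
set_option linter.dupNamespace false

noncomputable section

namespace Summit.ResolutionOfSingularities.ResolutionOfSingularities.Theorems.WildQuotientResolution.EigenlineChart

open IsLocalRing Literature.AlgebraicGeometry.Resolution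

universe u

/-! ## The maximal ideal of `S[𝔪/t]_𝔫` read in `K`: fractions `a/s`, `a ∈ 𝔫`, `s ∉ 𝔫` -/

section MaxFractions

variable {K : Type u} [Field K] {S : Subring K} [IsLocalRing S] {t : S}
  {𝔫 : Ideal (blowupRing S (t : K))} [h𝔫 : 𝔫.IsPrime]

/-- Elements of `𝔫` are such fractions (`a/1`). [folklore] -/
theorem exists_frac_of_mem {a : blowupRing S (t : K)} (ha : a ∈ 𝔫) :
    ∃ b s : blowupRing S (t : K), b ∈ 𝔫 ∧ s ∉ 𝔫 ∧ (a : K) = b / s :=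
  ⟨a, 1, ha, fun h1 => h𝔫.ne_top ((Ideal.eq_top_iff_one _).mpr h1), by simp⟩

/-- Such fractions lie in `S[𝔪/t]_𝔫`. [folklore] -/
theorem mem_ofPrime_of_frac {z : K}
    (hz : ∃ b s : blowupRing S (t : K), b ∈ 𝔫 ∧ s ∉ 𝔫 ∧ z = b / s) :
    z ∈ (LocalSubring.ofPrime (blowupRing S (t : K)) 𝔫).toSubring := by
  obtain ⟨b, s, -, hs, rfl⟩ := hz
  exact mem_ofPrime_iff.mpr ⟨b, s, hs, rfl⟩

/-- Sums of such fractions are such fractions. [folklore] -/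
theorem frac_add {z z' : K}
    (hz : ∃ b s : blowupRing S (t : K), b ∈ 𝔫 ∧ s ∉ 𝔫 ∧ z = b / s)
    (hz' : ∃ b s : blowupRing S (t : K), b ∈ 𝔫 ∧ s ∉ 𝔫 ∧ z' = b / s) :
    ∃ b s : blowupRing S (t : K), b ∈ 𝔫 ∧ s ∉ 𝔫 ∧ z + z' = b / s := by
  obtain ⟨b, s, hb, hs, rfl⟩ := hz
  obtain ⟨b', s', hb', hs', rfl⟩ := hz'
  refine ⟨b * s' + s * b', s * s', add_mem (𝔫.mul_mem_right _ hb) (𝔫.mul_mem_left _ hb'),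
    fun h => (h𝔫.mem_or_mem h).elim hs hs', ?_⟩
  rw [div_add_div _ _ (coe_ne_zero_of_not_mem hs) (coe_ne_zero_of_not_mem hs')]
  simp only [Subring.coe_add, Subring.coe_mul]

omit h𝔫 in
/-- Negatives of such fractions are such fractions. [folklore] -/
theorem frac_neg {z : K}
    (hz : ∃ b s : blowupRing S (t : K), b ∈ 𝔫 ∧ s ∉ 𝔫 ∧ z = b / s) :
    ∃ b s : blowupRing S (t : K), b ∈ 𝔫 ∧ s ∉ 𝔫 ∧ -z = b / s := by
  obtain ⟨b, s, hb, hs, rfl⟩ := hz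
  exact ⟨-b, s, neg_mem hb, hs, by rw [Subring.coe_neg, neg_div]⟩

/-- Differences of such fractions are such fractions. [folklore] -/
theorem frac_sub {z z' : K}
    (hz : ∃ b s : blowupRing S (t : K), b ∈ 𝔫 ∧ s ∉ 𝔫 ∧ z = b / s)
    (hz' : ∃ b s : blowupRing S (t : K), b ∈ 𝔫 ∧ s ∉ 𝔫 ∧ z' = b / s) :
    ∃ b s : blowupRing S (t : K), b ∈ 𝔫 ∧ s ∉ 𝔫 ∧ z - z' = b / s := by
  rw [sub_eq_add_neg]
  exact frac_add hz (frac_neg hz')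

/-- Multiples of such fractions by elements of `S[𝔪/t]_𝔫` are such fractions. [folklore] -/
theorem frac_mul_left {w z : K} (hw : w ∈ (LocalSubring.ofPrime (blowupRing S (t : K)) 𝔫).toSubring)
    (hz : ∃ b s : blowupRing S (t : K), b ∈ 𝔫 ∧ s ∉ 𝔫 ∧ z = b / s) :
    ∃ b s : blowupRing S (t : K), b ∈ 𝔫 ∧ s ∉ 𝔫 ∧ w * z = b / s := by
  obtain ⟨b, s, hb, hs, rfl⟩ := hz
  obtain ⟨a, s', hs', rfl⟩ := mem_ofPrime_iff.mp hw
  refine ⟨a * b, s' * s, 𝔫.mul_mem_left _ hb, fun h => (h𝔫.mem_or_mem h).elim hs' hs, ?_⟩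
  rw [div_mul_div_comm, Subring.coe_mul, Subring.coe_mul]

/-- … and on the right. [folklore] -/
theorem frac_mul_right {w z : K} (hz : ∃ b s : blowupRing S (t : K), b ∈ 𝔫 ∧ s ∉ 𝔫 ∧ z = b / s)
    (hw : w ∈ (LocalSubring.ofPrime (blowupRing S (t : K)) 𝔫).toSubring) :
    ∃ b s : blowupRing S (t : K), b ∈ 𝔫 ∧ s ∉ 𝔫 ∧ z * w = b / s := by
  rw [mul_comm]; exact frac_mul_left hw hz

/-- **A unit plus such a fraction is a unit of `S[𝔪/t]_𝔫`.** [folklore] -/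
theorem inv_add_mem_ofPrime {c : blowupRing S (t : K)} (hc : c ∉ 𝔫) {z : K}
    (hz : ∃ b s : blowupRing S (t : K), b ∈ 𝔫 ∧ s ∉ 𝔫 ∧ z = b / s) :
    ((c : K) + z)⁻¹ ∈ (LocalSubring.ofPrime (blowupRing S (t : K)) 𝔫).toSubring := by
  obtain ⟨b, s, hb, hs, rfl⟩ := hz
  have hs0 : ((s : blowupRing S (t : K)) : K) ≠ 0 := coe_ne_zero_of_not_mem hs
  have hcs : c * s + b ∉ 𝔫 := fun h => by
    have h' : c * s ∈ 𝔫 := by simpa using 𝔫.sub_mem h hb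
    exact (h𝔫.mem_or_mem h').elim hc hs
  refine mem_ofPrime_iff.mpr ⟨s, c * s + b, hcs, ?_⟩
  have e : (c : K) + (b : K) / (s : K) = ((c * s + b : blowupRing S (t : K)) : K) / (s : K) := by
    rw [Subring.coe_add, Subring.coe_mul]
    field_simp
  rw [e, inv_div]

/-- **Such fractions are non-units of `S[𝔪/t]_𝔫`**: zero, or with inverse outside. [folklore] -/
theorem eq_zero_or_inv_not_mem_of_frac {z : K}
    (hz : ∃ b s : blowupRing S (t : K), b ∈ 𝔫 ∧ s ∉ 𝔫 ∧ z = b / s) :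
    z = 0 ∨ z⁻¹ ∉ (LocalSubring.ofPrime (blowupRing S (t : K)) 𝔫).toSubring := by
  obtain ⟨b, s, hb, hs, rfl⟩ := hz
  by_cases hb0 : ((b : blowupRing S (t : K)) : K) = 0
  · exact Or.inl (by rw [hb0, zero_div])
  refine Or.inr fun hinv => ?_
  obtain ⟨a, s', hs', has⟩ := mem_ofPrime_iff.mp hinv
  have hs0 : ((s : blowupRing S (t : K)) : K) ≠ 0 := coe_ne_zero_of_not_mem hs
  have hs'0 : ((s' : blowupRing S (t : K)) : K) ≠ 0 := coe_ne_zero_of_not_mem hs'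
  rw [inv_div, div_eq_div_iff hb0 hs'0] at has
  have h : s * s' = a * b := Subtype.ext (by simpa [Subring.coe_mul] using has)
  exact (h𝔫.mem_or_mem (h ▸ 𝔫.mul_mem_left a hb)).elim hs hs'

end MaxFractions

/-! ## The equivariant quadratic transform along a stable tangent hyperplane -/

section Equivariant

variable {K : Type u} [Field K]

/-- `W/x_i ⊆ 𝔫`: for the chart origin `𝔫 ∋ x_i, x_j/x_i` over `𝔪` and an ideal `W ≤ (x_j : j ≠ i) + 𝔪²`, every
`w ∈ W` has `w/x_i ∈ 𝔫`. [folklore] -/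
theorem div_mem_chartOrigin_of_mem (S : Subring K) [IsLocalRing S] {d : ℕ} (x : Fin d → S)
    (hx : Ideal.span (Set.range x) = maximalIdeal S) (i : Fin d)
    (𝔫 : Ideal (blowupRing S ((x i : S) : K)))
    (hnj : ∀ j : Fin d, j ≠ i → ∀ hB : ((x j : S) : K) / ((x i : S) : K) ∈ blowupRing S ((x i : S) : K),
      (⟨_, hB⟩ : blowupRing S ((x i : S) : K)) ∈ 𝔫)
    (hover : ∀ s : S, s ∈ maximalIdeal S →
      (⟨(s : K), le_blowupRing S _ s.2⟩ : blowupRing S ((x i : S) : K)) ∈ 𝔫)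
    {W : Ideal S} (hWle : W ≤ Ideal.span (x '' {j | j ≠ i}) ⊔ maximalIdeal S ^ 2)
    {w : S} (hw : w ∈ W) (hB : (w : K) / ((x i : S) : K) ∈ blowupRing S ((x i : S) : K)) :
    (⟨(w : K) / ((x i : S) : K), hB⟩ : blowupRing S ((x i : S) : K)) ∈ 𝔫 := by
  classical
  have hxm : ∀ j, x j ∈ maximalIdeal S := fun j => hx ▸ Ideal.subset_span ⟨j, rfl⟩
  -- the property `y/x_i ∈ 𝔫`, in proof-irrelevant form, and its closure properties
  have hPzero : ∃ hB : ((0 : S) : K) / ((x i : S) : K) ∈ blowupRing S ((x i : S) : K),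
      (⟨_, hB⟩ : blowupRing S ((x i : S) : K)) ∈ 𝔫 := by
    have h0 : ((0 : S) : K) / ((x i : S) : K) = 0 := by rw [ZeroMemClass.coe_zero, zero_div]
    refine ⟨by rw [h0]; exact Subring.zero_mem _, ?_⟩
    have e : (⟨((0 : S) : K) / ((x i : S) : K), by rw [h0]; exact Subring.zero_mem _⟩ :
        blowupRing S ((x i : S) : K)) = 0 := Subtype.ext h0
    rw [e]; exact 𝔫.zero_mem
  have hPadd : ∀ y z : S,
      (∃ hB : (y : K) / ((x i : S) : K) ∈ blowupRing S ((x i : S) : K),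
        (⟨_, hB⟩ : blowupRing S ((x i : S) : K)) ∈ 𝔫) →
      (∃ hB : (z : K) / ((x i : S) : K) ∈ blowupRing S ((x i : S) : K),
        (⟨_, hB⟩ : blowupRing S ((x i : S) : K)) ∈ 𝔫) →
      ∃ hB : ((y + z : S) : K) / ((x i : S) : K) ∈ blowupRing S ((x i : S) : K),
        (⟨_, hB⟩ : blowupRing S ((x i : S) : K)) ∈ 𝔫 := by
    intro y z ⟨hyB, hy⟩ ⟨hzB, hz⟩
    have e0 : ((y + z : S) : K) / ((x i : S) : K) =
        (y : K) / ((x i : S) : K) + (z : K) / ((x i : S) : K) := by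
      rw [Subring.coe_add, add_div]
    refine ⟨by rw [e0]; exact add_mem hyB hzB, ?_⟩
    have e : (⟨((y + z : S) : K) / ((x i : S) : K), by rw [e0]; exact add_mem hyB hzB⟩ :
        blowupRing S ((x i : S) : K)) = ⟨_, hyB⟩ + ⟨_, hzB⟩ := Subtype.ext e0
    rw [e]; exact add_mem hy hz
  have hPmul : ∀ a y : S,
      (∃ hB : (y : K) / ((x i : S) : K) ∈ blowupRing S ((x i : S) : K),
        (⟨_, hB⟩ : blowupRing S ((x i : S) : K)) ∈ 𝔫) →
      ∃ hB : ((a * y : S) : K) / ((x i : S) : K) ∈ blowupRing S ((x i : S) : K),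
        (⟨_, hB⟩ : blowupRing S ((x i : S) : K)) ∈ 𝔫 := by
    intro a y ⟨hyB, hy⟩
    have haB : (a : K) ∈ blowupRing S ((x i : S) : K) := le_blowupRing S _ a.2
    have e0 : ((a * y : S) : K) / ((x i : S) : K) = (a : K) * ((y : K) / ((x i : S) : K)) := by
      rw [Subring.coe_mul, mul_div_assoc]
    refine ⟨by rw [e0]; exact mul_mem haB hyB, ?_⟩
    have e : (⟨((a * y : S) : K) / ((x i : S) : K), by rw [e0]; exact mul_mem haB hyB⟩ :
        blowupRing S ((x i : S) : K)) = ⟨_, haB⟩ * ⟨_, hyB⟩ := Subtype.ext e0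
    rw [e]; exact 𝔫.mul_mem_left _ hy
  -- the linear part `(x_j : j ≠ i)/x_i ⊆ 𝔫`
  have h₁ : ∀ y ∈ Ideal.span (x '' {j | j ≠ i}),
      ∃ hB : (y : K) / ((x i : S) : K) ∈ blowupRing S ((x i : S) : K),
        (⟨_, hB⟩ : blowupRing S ((x i : S) : K)) ∈ 𝔫 := by
    intro y hy
    induction hy using Submodule.span_induction with
    | mem y hy =>
      obtain ⟨j, hj, rfl⟩ := hy
      exact ⟨div_mem_blowupRing _ (hxm j), hnj j hj _⟩
    | zero => exact hPzero
    | add y z _ _ hy hz => exact hPadd y z hy hz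
    | smul a y _ hy => exact hPmul a y hy
  -- the quadratic part `𝔪²/x_i ⊆ 𝔪 · S[𝔪/x_i] ⊆ 𝔫`
  have h₂ : ∀ m ∈ maximalIdeal S ^ 2,
      ∃ hB : (m : K) / ((x i : S) : K) ∈ blowupRing S ((x i : S) : K),
        (⟨_, hB⟩ : blowupRing S ((x i : S) : K)) ∈ 𝔫 := by
    intro m hm
    rw [pow_two] at hm
    refine Submodule.mul_induction_on hm (fun y hy z hz => ?_) (fun y z hy hz => hPadd y z hy hz)
    have hyB : (y : K) ∈ blowupRing S ((x i : S) : K) := le_blowupRing S _ y.2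
    have hzB := div_mem_blowupRing ((x i : S) : K) hz
    have e0 : ((y * z : S) : K) / ((x i : S) : K) = (y : K) * ((z : K) / ((x i : S) : K)) := by
      rw [Subring.coe_mul, mul_div_assoc]
    refine ⟨by rw [e0]; exact mul_mem hyB hzB, ?_⟩
    have e : (⟨((y * z : S) : K) / ((x i : S) : K), by rw [e0]; exact mul_mem hyB hzB⟩ :
        blowupRing S ((x i : S) : K)) = ⟨_, hyB⟩ * ⟨_, hzB⟩ := Subtype.ext e0
    rw [e]; exact 𝔫.mul_mem_right _ (hover y hy)
  obtain ⟨w₁, hw₁, m, hm, hwm⟩ := Submodule.mem_sup.mp (hWle hw)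
  subst hwm
  obtain ⟨hB', h'⟩ := hPadd w₁ m (h₁ w₁ hw₁) (h₂ m hm)
  exact h'

/-- An ideal `W ≤ (x_j : j ≠ i) + 𝔪²` lies in `𝔪`. [folklore] -/
theorem le_maximalIdeal_of_le_hyperplane (S : Subring K) [IsLocalRing S] {d : ℕ} (x : Fin d → S)
    (hx : Ideal.span (Set.range x) = maximalIdeal S) (i : Fin d)
    {W : Ideal S} (hWle : W ≤ Ideal.span (x '' {j | j ≠ i}) ⊔ maximalIdeal S ^ 2) :
    W ≤ maximalIdeal S := by
  refine hWle.trans (sup_le ?_ (Ideal.pow_le_self two_ne_zero))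
  rw [← hx]
  exact Ideal.span_mono (Set.image_subset_range _ _)

end Equivariant

end Summit.ResolutionOfSingularities.ResolutionOfSingularities.Theorems.WildQuotientResolution.EigenlineChart

end
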